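import Mathlib.MeasureTheory.Integral.Lebesgue.Basic
import Mathlib.MeasureTheory.Constructions.BorelSpace.Basic
import Literature.Geometry.Lorentzian.LeviCivita
import Literature.Geometry.Lorentzian.Volume
import Literature.Geometry.Riemannian.IsotropicCurvature
import Literature.Geometry.Riemannian.RiemannianDistance
import HarnessLib

/-!
# The Weyl tensor in a frame, its pointwise norm `|W|²`, and the Weyl energy `∫_M |W|² dV`

Definitions (real, with bodies; NO named facts in this file — it is meant to sit in the import
cone of routes, see "Cone hygiene" below) of the conformally invariant energy of a Riemannian
metric that appears in the Chang–Gursky–Yang sphere theorem (Chang–Gursky–Yang 2003, Thm. A: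
`Y(M,[g]) > 0` and `∫_M |W|² dvol < 16π² χ(M)` on a closed `4`-manifold force `M ≅ S⁴` or `ℝP⁴`),
over the metric vocabulary of `Literature/Geometry/{Lorentzian,Riemannian}`: a `C^n` metric
`g : PseudoRiemannianMetric I n E (TangentSpace I : M → Type _)` with its Levi-Civita connection
`g.leviCivita` (standing instance hypothesis `[g.HasLeviCivita]`, `LeviCivita.lean`), covariant
curvature tensor `Rm(X,Y,Z,W) = g(R(X,Y)Z, W)` (`g.curvatureForm`, `IsotropicCurvature.lean`),
Ricci tensor `g.ricci` and scalar curvature `g.scalarCurvature`.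

* `g.weylFrame x e i j k l` — the component `W_{ijkl}` of the **Weyl tensor** of `g` at `x` in a
  frame `e : ι → T_x M` of size `m = |ι|` (meaningful for a `g_x`-ORTHONORMAL frame of size
  `m = dim M`):
  `W_{ijkl} = R_{ijkl} - (1/(m-2)) (Ric_{il} δ_{jk} + Ric_{jk} δ_{il} - Ric_{ik} δ_{jl} - Ric_{jl} δ_{ik})
             + (S/((m-1)(m-2))) (δ_{il} δ_{jk} - δ_{ik} δ_{jl})`,
  i.e. the orthonormal-frame components of `W = Rm - P ⊙ g`, `P = (1/(m-2))(Ric - S/(2(m-1)) g)`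
  the Schouten tensor and `⊙` the Kulkarni–Nomizu product, written in the slot convention of this
  tree (`Rm(X,Y,Z,W) = g(R(X,Y)Z,W)`, `K(X,Y) = Rm(X,Y,Y,X)`):
  `(h ⊙ k)_{ijkl} = h_{il} k_{jk} + h_{jk} k_{il} - h_{ik} k_{jl} - h_{jl} k_{ik}`. This is Besse 1987,
  1.110 (Kulkarni–Nomizu product), Thm. 1.114 and (1.116)–1.117 (the Weyl tensor = the Weyl part
  of `R`: `R = (s/(2n(n-1))) g ⊙ g + (1/(n-2)) z ⊙ g + W`, `z = r - (s/n) g`), transcribed from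
  Besse's slot convention `K(x,y) = R(x,y,x,y)` by exchanging the last two slots; in dimension `4`
  it is Chang–Gursky–Yang's `(0.1)`: `Riem = W + ½ E ⊙ g + (1/24) R g ⊙ g`, `E = Ric - ¼ R g`
  (Lee 2018, Ch. 7, treats the same objects as "Schouten" and "Weyl" tensors);
* `g.weylNormSqFrame x e = Σ_{ijkl} W_{ijkl}²` — the frame expression of the squared `(0,4)`-norm
  `|W|² = W_{ijkl} W^{ijkl}` (Chang–Gursky–Yang 2003, Remark 2 after Thm. A: "the usual definition
  when `W` is viewed as a section of `⊗⁴ T*M`"; NOT the `End(Λ²)`-norm `¼ W_{ijkl}W^{ijkl}`);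
* `g.weylNormSq x = |W_g|²(x)` — the pointwise squared norm of the Weyl tensor: the value of
  `weylNormSqFrame` on any `g_x`-orthonormal frame `e : Fin (dim M) → T_x M` (an orthonormal
  basis). The frame expression is the full contraction of the `4`-tensor `W` with the inner product
  `g_x`, hence independent of the orthonormal basis (elementary linear algebra); to avoid CHOOSING a
  basis the definition takes the supremum over all orthonormal frames of this frame-independent
  quantity (`⨆` over an empty index set — non-Riemannian `g_x`, where no `g_x`-orthonormal basis
  exists — is the junk value `0`);
* `g.weylEnergy = ∫_M |W_g|² dV_g ∈ [0, ∞]` — the **Weyl energy** (Chang–Gursky–Yang 2003, (0.3);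
  the "Weyl functional `g ↦ ∫ |W|² dvol`", ibid. p. 3), a lower Lebesgue integral of
  `ENNReal.ofReal |W|²` against the Riemannian measure `dV_g`
  (`Literature.Geometry.Lorentzian.riemannianMeasure` of `Volume.lean`: the Euclidean-normalised
  Hausdorff measure of the Riemannian distance, `= √(det g_{ij}) dx` in charts by the PROVED chart
  formula `riemannianMeasure_eq_integral_sqrt_det_holds`), for the Borel σ-algebra of `M`; the junk
  value `0` when `g` is not Riemannian.

## Conventions pinned (Chang–Gursky–Yang 2003, (0.1)–(0.4), arXiv:math/0309287 pp. 1–2)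

* `R(X,Y)Z = ∇_X ∇_Y Z - ∇_Y ∇_X Z - ∇_{[X,Y]} Z`, `Rm(X,Y,Z,W) = g(R(X,Y)Z,W)` (`LeviCivita.lean`,
  `IsotropicCurvature.lean`; Lee's convention), so `K(eᵢ,eⱼ) = Rm(eᵢ,eⱼ,eⱼ,eᵢ)`,
  `Ric(Y,Z) = Σᵢ Rm(eᵢ,Y,Z,eᵢ)` (`g.ricci = tr (v ↦ R(v,·)·)`), `S = tr_g Ric`, and constant
  curvature `c` reads `Rm = (c/2) g ⊙ g`. With these conventions `W` above is totally trace-free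
  (`Σᵢ W_{ijki} = 0` for symmetric `Ric`), i.e. it IS the Weyl part of the `O(m)`-decomposition of
  `Rm`; `|W|²` does not depend on the sign conventions.
* `(0,4)`-norm, so that Chern–Gauss–Bonnet reads `8π² χ(M) = ∫ (¼|W|² - ½|E|² + R²/24) dV`
  (ibid. (0.4)) and the sphere-theorem threshold is `∫ |W|² dV < 16π² χ(M)` (ibid. (0.3)).
* The Ricci and scalar terms are the tensorial `g.ricci`, `g.scalarCurvature` of `LeviCivita.lean`
  (for an orthonormal frame they equal the frame sums `Σᵢ R_{iabi}`, `Σ_{ab} …`).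

## Cone hygiene (why the measure is not `riemVolume`)

`PseudoRiemannianMetric.riemVolume` (`Riemannian/CanonicalNeighbourhoods.lean`) is the same
measure but lives in a file importing the Ricci-flow-with-surgery development; this file imports
only `LeviCivita` / `IsotropicCurvature` / `RiemannianDistance` / `Lorentzian.Volume` (whose two
named facts are discharged in `VolumeProofs.lean` and `VolumeChartFormula.lean`) and Mathlib, and
declares no `def … : Prop`. Named FACTS about the Weyl energy (Chern–Gauss–Bonnet,
Chang–Gursky–Yang Thm. A) belong in separate files (`ChangGurskyYang.lean`).

## What is NOT here

Frame independence of `weylNormSqFrame` on orthonormal bases (so that `weylNormSq` equals the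
frame value — a lemma, not part of the definition), `|W|² = |Rm|² - (4/(m-2))|Ric|² +
(2/((m-1)(m-2))) S²`, `W = 0` in dimension `3`, conformal invariance `W_{e^{2u}g} = e^{2u} W_g` and
the scale invariance of `∫|W|² dV` in dimension `4`, vanishing for locally conformally flat metrics.
Mathlib has no Weyl/Schouten tensor and no Riemannian volume (searched `Weyl`, `Schouten`,
`Kulkarni`, `riemannianVolume` in `Mathlib/Geometry`).

## References

* S.-Y. A. Chang, M. J. Gursky, P. C. Yang, *A conformally invariant sphere theorem in four
  dimensions*, Publ. Math. IHÉS 98 (2003) 105–143 (arXiv:math/0309287), (0.1)–(0.4), Thm. A and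
  Remark 2. [ChangGurskyYang2003]
* A. L. Besse, *Einstein Manifolds* (1987), 1.110 (Kulkarni–Nomizu product), Thm. 1.114
  (decomposition of curvature tensors), (1.116)–1.117 (the Weyl tensor), 1.119 (`n = 2, 3`).
  [Besse1987]
* J. M. Lee, *Introduction to Riemannian Manifolds*, 2nd ed. (2018), Ch. 7 (curvature conventions
  `Rm`, `Ric`, `S` used by `LeviCivita.lean` / `IsotropicCurvature.lean`; Schouten and Weyl
  tensors). [Lee2018]
-/

noncomputable section

open Bundle MeasureTheory
open scoped Manifold ContDiff Topology ENNReal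

namespace Literature.Geometry.Riemannian

open Literature.Geometry.Lorentzian (PseudoRiemannianMetric riemannianMeasure)
open Literature.Geometry.Lorentzian.PseudoRiemannianMetric

variable {E : Type*} [NormedAddCommGroup E] [NormedSpace ℝ E] {H : Type*} [TopologicalSpace H]
  {I : ModelWithCorners ℝ E H} {M : Type*} [TopologicalSpace M] [ChartedSpace H M]
  [IsManifold I ∞ M] {n : ℕ∞ω}

variable (g : PseudoRiemannianMetric I n E (TangentSpace I : M → Type _))
variable [FiniteDimensional ℝ E] [g.HasLeviCivita]

/-! ### The Weyl tensor in a frame -/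

/-- **The Weyl tensor of `g` at `x` in the frame `e : ι → T_x M`** (size `m = |ι|`), component
`W_{ijkl} = R_{ijkl} - (1/(m-2)) (Ric_{il} δ_{jk} + Ric_{jk} δ_{il} - Ric_{ik} δ_{jl} - Ric_{jl} δ_{ik})
  + (S/((m-1)(m-2))) (δ_{il} δ_{jk} - δ_{ik} δ_{jl})`,
with `R_{ijkl} = Rm(eᵢ,eⱼ,e_k,e_l) = g(R(eᵢ,eⱼ)e_k, e_l)` (`g.curvatureForm g.leviCivita`),
`Ric_{ab} = g.ricci x (e a) (e b)`, `S = g.scalarCurvature x`, `δ` the Kronecker symbol: the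
orthonormal-frame components of the Weyl part `W = Rm - P ⊙ g` of the curvature tensor (`P` the
Schouten tensor, `⊙` the Kulkarni–Nomizu product; Besse 1987, 1.110, Thm. 1.114, (1.116)–1.117:
`R = (s/(2n(n-1))) g ⊙ g + (1/(n-2)) z ⊙ g + W`, `z = r - (s/n) g`, transcribed into the slot
convention `K(X,Y) = Rm(X,Y,Y,X)` of this tree; in dimension `4` Chang–Gursky–Yang's (0.1),
`Riem = W + ½ E ⊙ g + (1/24) R g ⊙ g`). With these conventions `Σᵢ W_{ijki} = 0` (total
trace-freeness, given the symmetry of `Ric`). Meaningful for a `g_x`-orthonormal frame with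
`m = dim M ≥ 3` (for `m ≤ 2` the coefficients are Lean's junk `x/0 = 0`; Besse assumes `n ≥ 4`).
[cite: Besse1987, 1.110 and (1.116)–1.117] [cite: ChangGurskyYang2003, (0.1)] -/
def _root_.Literature.Geometry.Lorentzian.PseudoRiemannianMetric.weylFrame (x : M) {ι : Type*}
    [Fintype ι] [DecidableEq ι] (e : ι → TangentSpace I x) (i j k l : ι) : ℝ :=
  let m : ℝ := Fintype.card ι
  let Rm : ι → ι → ι → ι → ℝ := fun a b c d ↦ g.curvatureForm g.leviCivita x (e a) (e b) (e c) (e d)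
  let Rc : ι → ι → ℝ := fun a b ↦ g.ricci x (e a) (e b)
  let S : ℝ := g.scalarCurvature x
  let δ : ι → ι → ℝ := fun a b ↦ if a = b then 1 else 0
  Rm i j k l - 1 / (m - 2) * (Rc i l * δ j k + Rc j k * δ i l - Rc i k * δ j l - Rc j l * δ i k) +
    S / ((m - 1) * (m - 2)) * (δ i l * δ j k - δ i k * δ j l)

/-- Unfolding of `weylFrame`. [cite: Besse1987, (1.116)] -/
theorem _root_.Literature.Geometry.Lorentzian.PseudoRiemannianMetric.weylFrame_apply (x : M)
    {ι : Type*} [Fintype ι] [DecidableEq ι] (e : ι → TangentSpace I x) (i j k l : ι) :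
    g.weylFrame x e i j k l =
      g.curvatureForm g.leviCivita x (e i) (e j) (e k) (e l) -
        1 / ((Fintype.card ι : ℝ) - 2) *
          (g.ricci x (e i) (e l) * (if j = k then 1 else 0) +
            g.ricci x (e j) (e k) * (if i = l then 1 else 0) -
            g.ricci x (e i) (e k) * (if j = l then 1 else 0) -
            g.ricci x (e j) (e l) * (if i = k then 1 else 0)) +
        g.scalarCurvature x / (((Fintype.card ι : ℝ) - 1) * ((Fintype.card ι : ℝ) - 2)) *
          ((if i = l then 1 else 0) * (if j = k then 1 else 0) -
            (if i = k then 1 else 0) * (if j = l then 1 else 0)) :=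
  rfl

/-- In dimension `4` (frames indexed by `Fin 4`) the coefficients are `½` and `S/6`:
`W_{ijkl} = R_{ijkl} - ½ (Ric_{il} δ_{jk} + Ric_{jk} δ_{il} - Ric_{ik} δ_{jl} - Ric_{jl} δ_{ik})
  + (S/6) (δ_{il} δ_{jk} - δ_{ik} δ_{jl})`, i.e. `W = Riem - ½ E ⊙ g - (R/24) g ⊙ g` with
`E = Ric - ¼ R g`. [cite: ChangGurskyYang2003, (0.1)] -/
theorem _root_.Literature.Geometry.Lorentzian.PseudoRiemannianMetric.weylFrame_fin_four (x : M)
    (e : Fin 4 → TangentSpace I x) (i j k l : Fin 4) :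
    g.weylFrame x e i j k l =
      g.curvatureForm g.leviCivita x (e i) (e j) (e k) (e l) -
        1 / 2 *
          (g.ricci x (e i) (e l) * (if j = k then 1 else 0) +
            g.ricci x (e j) (e k) * (if i = l then 1 else 0) -
            g.ricci x (e i) (e k) * (if j = l then 1 else 0) -
            g.ricci x (e j) (e l) * (if i = k then 1 else 0)) +
        g.scalarCurvature x / 6 *
          ((if i = l then 1 else 0) * (if j = k then 1 else 0) -
            (if i = k then 1 else 0) * (if j = l then 1 else 0)) := by
  rw [weylFrame_apply, Fintype.card_fin]
  norm_num

/-- `W` inherits antisymmetry in the first two slots from `Rm` (`curvatureForm_antisymm`) and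
the corresponding antisymmetry of the Ricci/scalar terms. [folklore] -/
theorem _root_.Literature.Geometry.Lorentzian.PseudoRiemannianMetric.weylFrame_antisymm (x : M)
    {ι : Type*} [Fintype ι] [DecidableEq ι] (e : ι → TangentSpace I x) (i j k l : ι) :
    g.weylFrame x e i j k l = - g.weylFrame x e j i k l := by
  rw [weylFrame_apply, weylFrame_apply, g.curvatureForm_antisymm g.leviCivita x (e i) (e j)]
  ring

/-- **`W` is totally trace-free** (it is the Weyl part of the curvature tensor, Besse 1987,
Thm. 1.114: `𝒲E = Ker c`): if the frame `e` (of size `m ≥ 3`) computes the Ricci contraction and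
the scalar curvature — `Σᵢ Rm(eᵢ, e_a, e_b, eᵢ) = Ric(e_a, e_b)` and `Σᵢ Ric(eᵢ, eᵢ) = S`, as every
`g_x`-orthonormal basis of a Riemannian metric does — then `Σᵢ W_{ijki} = 0`. This pins the signs
and coefficients of the Ricci and scalar corrections in `weylFrame`. [cite: Besse1987, Thm. 1.114 and (1.116)] -/
theorem _root_.Literature.Geometry.Lorentzian.PseudoRiemannianMetric.sum_weylFrame_eq_zero (x : M)
    {ι : Type*} [Fintype ι] [DecidableEq ι] (e : ι → TangentSpace I x) (hcard : 3 ≤ Fintype.card ι)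
    (hRic : ∀ a b, ∑ i, g.curvatureForm g.leviCivita x (e i) (e a) (e b) (e i) = g.ricci x (e a) (e b))
    (hS : ∑ i, g.ricci x (e i) (e i) = g.scalarCurvature x) (j k : ι) :
    ∑ i, g.weylFrame x e i j k i = 0 := by
  have h3 : (3 : ℝ) ≤ Fintype.card ι := by exact_mod_cast hcard
  have hm2 : (Fintype.card ι : ℝ) - 2 ≠ 0 := by linarith
  have hm1 : (Fintype.card ι : ℝ) - 1 ≠ 0 := by linarith
  simp only [weylFrame_apply, if_true, Finset.sum_add_distrib, Finset.sum_sub_distrib,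
    ← Finset.mul_sum, ← Finset.sum_mul, hRic, hS]
  simp only [Finset.sum_ite_eq, Finset.sum_ite_eq', Finset.mem_univ, if_true, mul_ite, mul_one,
    mul_zero, one_mul, Finset.sum_const, Finset.card_univ, nsmul_eq_mul]
  by_cases hjk : j = k
  · simp only [hjk, if_true]
    field_simp
    ring
  · simp only [hjk, if_false]
    field_simp
    ring

/-! ### The pointwise norm `|W|²` -/

/-- **`Σ_{ijkl} W_{ijkl}²`, the frame expression of `|W|² = W_{ijkl} W^{ijkl}`** (the
`(0,4)`-tensor norm of Chang–Gursky–Yang 2003, Remark 2 after Thm. A — NOT the `End(Λ²)` norm,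
which is `¼` of it), for a frame `e : ι → T_x M`; it is the squared norm of the Weyl tensor when
`e` is a `g_x`-orthonormal basis. [cite: ChangGurskyYang2003, Thm. A, Remark 2] -/
def _root_.Literature.Geometry.Lorentzian.PseudoRiemannianMetric.weylNormSqFrame (x : M)
    {ι : Type*} [Fintype ι] [DecidableEq ι] (e : ι → TangentSpace I x) : ℝ :=
  ∑ i, ∑ j, ∑ k, ∑ l, g.weylFrame x e i j k l ^ 2

/-- The frame expression of `|W|²` is a sum of squares, hence nonnegative. [folklore] -/
theorem _root_.Literature.Geometry.Lorentzian.PseudoRiemannianMetric.weylNormSqFrame_nonneg (x : M)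
    {ι : Type*} [Fintype ι] [DecidableEq ι] (e : ι → TangentSpace I x) :
    0 ≤ g.weylNormSqFrame x e :=
  Finset.sum_nonneg fun _ _ ↦ Finset.sum_nonneg fun _ _ ↦ Finset.sum_nonneg fun _ _ ↦
    Finset.sum_nonneg fun _ _ ↦ sq_nonneg _

/-- If all Weyl components vanish in the frame `e`, the frame norm vanishes. [folklore] -/
theorem _root_.Literature.Geometry.Lorentzian.PseudoRiemannianMetric.weylNormSqFrame_eq_zero (x : M)
    {ι : Type*} [Fintype ι] [DecidableEq ι] {e : ι → TangentSpace I x}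
    (h : ∀ i j k l, g.weylFrame x e i j k l = 0) : g.weylNormSqFrame x e = 0 := by
  simp [weylNormSqFrame, h]

/-- **The pointwise squared norm `|W_g|²(x)` of the Weyl tensor** (`(0,4)`-norm,
`|W|² = W_{ijkl}W^{ijkl}`, Chang–Gursky–Yang 2003, Remark 2 after Thm. A): the value of
`Σ_{ijkl} W_{ijkl}²` (`weylNormSqFrame`) on a `g_x`-orthonormal basis
`e : Fin (dim M) → T_x M` (`dim M = finrank ℝ E`). That value is the full contraction of `W ⊗ W`
with `g_x`, hence the same for every orthonormal basis; the definition therefore takes the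
supremum over the (nonempty, for Riemannian `g`) set of `g_x`-orthonormal frames of this
frame-independent quantity instead of choosing a frame. Junk value `0` (`⨆` over an empty type)
when `T_x M` has no `g_x`-orthonormal basis, i.e. when `g_x` is not positive definite.
[cite: ChangGurskyYang2003, Thm. A, Remark 2] [cite: Besse1987, 1.117] -/
def _root_.Literature.Geometry.Lorentzian.PseudoRiemannianMetric.weylNormSq (x : M) : ℝ :=
  ⨆ e : {e : Fin (Module.finrank ℝ E) → TangentSpace I x // g.IsOrthonormalFrame x e},
    g.weylNormSqFrame x e.1

/-- `|W|²(x) ≥ 0` (a supremum of nonnegative frame sums; also in the junk case). [folklore] -/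
theorem _root_.Literature.Geometry.Lorentzian.PseudoRiemannianMetric.weylNormSq_nonneg (x : M) :
    0 ≤ g.weylNormSq x := by
  unfold weylNormSq
  exact Real.iSup_nonneg fun e ↦ g.weylNormSqFrame_nonneg x e.1

/-- If every `g_x`-orthonormal basis has vanishing Weyl components (e.g. at a point where the
curvature tensor, hence `Ric` and `S`, vanish), then `|W|²(x) = 0`. [folklore] -/
theorem _root_.Literature.Geometry.Lorentzian.PseudoRiemannianMetric.weylNormSq_eq_zero (x : M)
    (h : ∀ e : Fin (Module.finrank ℝ E) → TangentSpace I x, g.IsOrthonormalFrame x e →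
      ∀ i j k l, g.weylFrame x e i j k l = 0) :
    g.weylNormSq x = 0 := by
  unfold weylNormSq
  have : ∀ e : {e : Fin (Module.finrank ℝ E) → TangentSpace I x // g.IsOrthonormalFrame x e},
      g.weylNormSqFrame x e.1 = 0 := fun e ↦ g.weylNormSqFrame_eq_zero x (h e.1 e.2)
  simp [this]

/-! ### The Weyl energy `∫_M |W|² dV` -/

/-- **The Weyl energy `𝒲(g) = ∫_M |W_g|² dV_g`** of a Riemannian metric `g` (Chang–Gursky–Yang
2003, (0.3) and p. 3, "the Weyl functional `g ↦ ∫ |W|² dvol`"; with the `(0,4)`-norm, so that the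
conformally invariant sphere theorem reads `∫|W|² dV < 16π² χ(M)`), valued in `ℝ≥0∞`: the lower
Lebesgue integral of `ENNReal.ofReal (|W_g|²(x))` (`weylNormSq`) against the Riemannian measure
`dV_g = riemannianMeasure (g.toContMDiffRiemannianMetric hg)` of `Volume.lean` (Euclidean-normalised
top-dimensional Hausdorff measure of the Riemannian distance; `= √(det g_{ij}) dx` in charts), taken
for the Borel σ-algebra `borel M` (so no measurable-space instance on `M` is needed; any
`[BorelSpace M]` instance agrees, `weylEnergy_eq`). `M` is assumed Hausdorff; as a finite-dimensional
manifold it is then locally compact and `T₃`, which the length-metric construction needs. Junk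
value `0` when `g` is not Riemannian (`weylEnergy_of_not_isRiemannian`). Finite on closed manifolds
for smooth `g` (continuity of `|W|²` and finiteness of the volume — not proved here).
[cite: ChangGurskyYang2003, Thm. A, (0.3)] -/
def _root_.Literature.Geometry.Lorentzian.PseudoRiemannianMetric.weylEnergy [T2Space M] : ℝ≥0∞ :=
  haveI : LocallyCompactSpace M := Manifold.locallyCompact_of_finiteDimensional I
  letI : MeasurableSpace M := borel M
  haveI : BorelSpace M := ⟨rfl⟩
  open scoped Classical in
  if hg : g.IsRiemannian then
    ∫⁻ x, ENNReal.ofReal (g.weylNormSq x) ∂(riemannianMeasure (g.toContMDiffRiemannianMetric hg))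
  else 0

/-- For a non-Riemannian `g` the Weyl energy is the junk value `0`. [folklore] -/
theorem _root_.Literature.Geometry.Lorentzian.PseudoRiemannianMetric.weylEnergy_of_not_isRiemannian
    [T2Space M] (hg : ¬ g.IsRiemannian) : g.weylEnergy = 0 := by
  unfold weylEnergy
  simp [hg]

/-- **Unfolding of the Weyl energy**: for a Riemannian `g`, and with respect to any Borel
measurable structure on `M` (and any `T₃` witness), `g.weylEnergy = ∫⁻ |W_g|² dV_g`.
[cite: ChangGurskyYang2003, Thm. A, (0.3)] -/
theorem _root_.Literature.Geometry.Lorentzian.PseudoRiemannianMetric.weylEnergy_eq [T2Space M]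
    [T3Space M] [MeasurableSpace M] [BorelSpace M] (hg : g.IsRiemannian) :
    g.weylEnergy =
      ∫⁻ x, ENNReal.ofReal (g.weylNormSq x) ∂(riemannianMeasure (g.toContMDiffRiemannianMetric hg)) := by
  have hm : ‹MeasurableSpace M› = borel M := BorelSpace.measurable_eq
  subst hm
  unfold weylEnergy
  rw [dif_pos hg]

/-- The Weyl energy vanishes as soon as `|W_g|²` vanishes identically (e.g. for a metric whose
Weyl tensor vanishes in every orthonormal frame — flat or, more generally, locally conformally
flat metrics, once `W = 0` is known for them). [folklore] -/
theorem _root_.Literature.Geometry.Lorentzian.PseudoRiemannianMetric.weylEnergy_eq_zero_of_weylNormSq_eq_zero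
    [T2Space M] (h : ∀ x, g.weylNormSq x = 0) : g.weylEnergy = 0 := by
  unfold weylEnergy
  split_ifs with hg
  · simp [h]
  · rfl

end Literature.Geometry.Riemannian
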